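import Summits.HodgeConjecture.HodgeConjecture.Theorems.F0P3CohClassRoutingCotOfS2Sharp   -- ★ p835874: `kcTrivial_of_isCot`, `cotSpherical`, `localRouting` (+ ★ `F0P3CohClassRoutingCot` texts)
import HarnessLib

/-!
# Crux `H413`, line LH1 — DEBT PARTITION BY THEOREM: the closer's `stub_L3` type `CohClassRoutingCotClosed` follows from ORGAN FIN of the
# S2♯ pay-down line ALONE (the two archimedean PIN organs are owed only to P2's Day-X `pkPi_of_tokens h80`)

Cell `hodgecm-mathlib`, F0∕P3c line LH1 (closer stub `stub_S2sharp` of `Cruxes/H413/Lines/F0_U3LettersRung1.lean` ED. 38, books row #80 S2♯), crux item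
`stmt-HodgeConjecture-24833`; LH1-p04 (g0) on LH1-plan (g0)'s DEALS ROUND 2 (2026-09-02T02:25:21Z, hand (h1)).  PROOF lane: THEOREMS ONLY (no `def`, no
instance declaration, no notation, no named fact, no `sorry`); never imports a `Cruxes/…/Lines` module; `--supports stmt-HodgeConjecture-24833 --as helper`.
HONEST LABEL: HC_CM is proved only modulo the 7 printed citations (2 remaining: hLiu418 = stmt-HodgeConjecture-24832, h413 = stmt-HodgeConjecture-24833)
until rung 0 closes; this file pays NOTHING — it records, as a kernel-checked implication, which organ of the LH1 pay-down line the closer actually consumes.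

THE OBSERVATION.  The pay-down LEAF `Cruxes/H413/Lines/F0_P3c_S2SharpPaydown.lean` (10355e03d0b94504) cuts S2♯ ★
`Rogawski1990.cohDiscrete_memXiFamily_archPinned` into three printed organs FIN `stub_S2fin : S2FinLetter` (∃ ξ, `MemXiFamily P … ξ` — the finite places),
PIN-ι `stub_S2pinIota` and PIN-τ `stub_S2pinCompact` (the archimedean pins), with a proved head.  The closer's ONLY consumer of `stub_S2sharp` is
`stub_L3 := ★ F0P3CohClassRoutingCotOfS2Sharp.cohClassRoutingCotClosed_of_s2sharp stub_S2sharp`, and that ★ proof calls S2♯ through its READ-BACK 1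
`.memXiFamily` only — i.e. through the text of ORGAN FIN.  This file makes the partition citable BY NAME: `cohClassRoutingCotClosed_of_s2Fin : ‹S2FinLetter› →
CohClassRoutingCotClosed` (the FIN text restated token for token as the hypothesis; proof = ★ `kcTrivial_of_isCot` for hypothesis (ii), ★ `cotSpherical` for the
cofinite spherical constituent, ★ `localRouting` for the routing).  BOOKS READING (director's digits, not asserted by the kernel): of the three organs of #80's
pay-down line, the h413 closer chain `stub_S2sharp → stub_L3` rests on FIN alone; PIN-ι ∧ PIN-τ are owed solely to programme P2's Day-X socket ★
`F0P2vPKPiOfTokens.pkPi_of_tokens (h80 : cohDiscrete_memXiFamily_archPinned)` (which reads the pin through ★ `XiArchPinned` → ★ `rigInf_node_of_xiArchPinned`).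
FIN itself is rung-5 print [Rogawski1990 Thm. 14.6.4; §15.3 ¶1 + Thm. 13.3.6 (c)]: a cotangent `P` lies in `Π′(ξ)` for a one-dimensional `ξ` — stable base change
`U(3) → GL₃∕L`; implied by name by ★ S2♭ `Rogawski1990.cohDiscrete_memXiFamily` (#70) and by S2♯ (#80) (LEAF read-backs `s2Fin_of_S2flat` ∕ `s2Fin_of_S2sharp`).

* §1 `cohClassRoutingCot_of_s2Fin` — one closer frame: ‹S2FinLetter› → `CohClassRoutingCot L H hH hHd μω hμu μZ keys ι T hT μ`.
* §2 `cohClassRoutingCotClosed_of_s2Fin` — all frames: ‹S2FinLetter› → `CohClassRoutingCotClosed` (the TYPE of the closer's `stub_L3`).  Axioms = TRIO.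

References: [Rogawski1990] J. Rogawski, *Automorphic Representations of Unitary Groups in Three Variables*, Ann. of Math. Stud. 123 (1990): §15.3 ¶1 (p. 249),
Thm. 13.3.6 (c) (p. 202), §14.6 Thm. 14.6.4 (p. 243), §13.1 p. 199, §12.2 (2) p. 174, §4.13 Lemma 4.13.1 (b), §14.2 pp. 232–234; [FlathCorvallis1979] D. Flath,
*Decomposition of representations into tensor products*, Proc. Sympos. Pure Math. 33.1 (1979), Thm. 3; [BorelWallach2000] A. Borel, N. Wallach, 2nd ed., VI Thm. 4.11.
-/

-- Mathlib idiom (as in ★ `F0P3CohClassRoutingCot`, ★ `CohDiscreteMemXiFamilyArchPinned`): the commutator bracket on `Module.End ℂ M`, needed to MENTION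
-- `(uFormGroup (Fin 2) (Fin 1)).lie →ₗ⁅ℝ⁆ Module.End ℂ M` in the FIN text (the hypothesis is the organ's text token for token; no Lines import is allowed).
attribute [local instance 100] LieRing.ofAssociativeRing

set_option autoImplicit false
-- the mandated namespace repeats `HodgeConjecture.HodgeConjecture`, as in every `Theorems/*.lean` of this sub-problem
set_option linter.dupNamespace false

noncomputable section

open NumberField IsDedekindDomain MeasureTheory Filter
open Literature.NumberTheory.Rogawski1990 Literature.NumberTheory.GaloisRepresentations
open Literature.NumberTheory.Automorphic Literature.NumberTheory.Automorphic.UnitaryGroup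
open Literature.NumberTheory.Automorphic.UnitaryGroup.CotangentForms
open Literature.RepresentationTheory.BorelWallach2000 Literature.RepresentationTheory.KonnoKonno2007
open Literature.RepresentationTheory.KonnoKonno2007.RealDualPair Literature.RepresentationTheory.KonnoKonno2007.RealDualPair.UForm
open scoped Matrix Classical ComplexOrder

namespace Summit.HodgeConjecture.HodgeConjecture.Cruxes.H413.F0P3cCohClassRoutingCotOfS2Fin

open Summit.HodgeConjecture.HodgeConjecture.Cruxes.H413.F0P3InnerFormClassificationV6
open Summit.HodgeConjecture.HodgeConjecture.Cruxes.H413.F0P3ClassTokenChoice (clFinChoice admUnitConstituents)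
open Summit.HodgeConjecture.HodgeConjecture.Cruxes.H413.F0P3CohClassRoutingCot (RoutesAt CohClassRoutingCot CohClassRoutingCotClosed)
open Summit.HodgeConjecture.HodgeConjecture.Cruxes.H413.F0P3CohClassRoutingCotOfS2Sharp (kcTrivial_of_isCot cotSpherical localRouting)

variable (L : Type) [Field L] [NumberField L] [IsCMField L] (H : Matrix (Fin 3) (Fin 3) L)
  (hH : (H.map (cmConjRingHom L))ᵀ = H) (hHd : IsUnit H.det) (μω : HeckeCharacter L) (hμu : μω.IsUnitary)
  [∀ v : HeightOneSpectrum (𝓞 ↥(maximalRealSubfield L)), MeasurableSpace (Gqs L v ⧸ Subgroup.center (Gqs L v))]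
  (μZ : ∀ v : HeightOneSpectrum (𝓞 ↥(maximalRealSubfield L)), Measure (Gqs L v ⧸ Subgroup.center (Gqs L v)))
  (keys : ∀ (ξ : OneDimAutRepH L) (v : HeightOneSpectrum (𝓞 ↥(maximalRealSubfield L))),
    (∀ w : PlacesOver L v, IsCMField.complexConj L • w.1 = w.1) →
      {p : IrrClass (Gqs L v) × IrrClass (Gqs L v) //
        KeysCaseTwoLabels L v (μω.semilocalComponent L v) (torusLocalComponent L (IsCMField.complexConj L) v ξ.η)
          (torusLocalComponent L (IsCMField.complexConj L) v ξ.ψ) p.1 p.2 ∧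
        p.1.IsSquareIntegrable (μZ v) ∧ ¬ p.2.IsSquareIntegrable (μZ v)})
  (ι : L →+* ℂ) (T : GL (Fin 3) ℂ)
  (hT : (T : Matrix (Fin 3) (Fin 3) ℂ)ᴴ * H.map ι * (T : Matrix (Fin 3) (Fin 3) ℂ) = Literature.Geometry.ComplexHyperbolic.BallModel.J)
  (μ : Measure (Gp L H).automorphicQuotient) [(Gp L H).IsAutomorphicMeasure μ]

/-! ## §1 One closer frame: the guarded routing letter from ORGAN FIN -/

/-- **`CohClassRoutingCot` FROM ORGAN FIN (one frame).**  Hypothesis `hFin` = the text of the LEAF's `S2FinLetter` token for token (letter frame; for every discrete `P`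
of holomorphic-or-antiholomorphic cotangent type at the CM frame, `K_c`-trivial, with a `(𝔤,K)`-token at `ι` into an irreducible module carrying a degree-one class of type
`δ = ±1`: `∃ ξ, MemXiFamily P … μω hμu ξ`).  Proof = ★ `cohClassRoutingCot_of_s2sharp` with S2♯'s READ-BACK 1 replaced by `hFin`: `K_c`-triviality of a cotangent `P` is ★
`kcTrivial_of_isCot`, the cofinite spherical constituent is ★ `cotSpherical`, the routing off a finite `S₁` is ★ `localRouting`.  PRINT behind FIN (rung 5, not proved
here): a cotangent `P` is of type `Π′(ξ)` for a one-dimensional `ξ`. [cite: Rogawski1990, §15.3 ¶1 (p. 249); Thm. 13.3.6 (c) (p. 202); §14.6 Thm. 14.6.4 (p. 243); §13.1 p. 199; §12.2 (2) p. 174]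
[cite: FlathCorvallis1979, Thm. 3] -/
theorem cohClassRoutingCot_of_s2Fin [∀ v : HeightOneSpectrum (𝓞 ↥(maximalRealSubfield L)), BorelSpace (Gqs L v ⧸ Subgroup.center (Gqs L v))]
    [∀ v : HeightOneSpectrum (𝓞 ↥(maximalRealSubfield L)), (μZ v).IsHaarMeasure]
    (hFin : ∀ (L : Type) [Field L] [NumberField L] [IsCMField L] (ι : L →+* ℂ) (H : Matrix (Fin 3) (Fin 3) L) (T : GL (Fin 3) ℂ)
      (hT : (T : Matrix (Fin 3) (Fin 3) ℂ)ᴴ * H.map ι * (T : Matrix (Fin 3) (Fin 3) ℂ) = Literature.Geometry.ComplexHyperbolic.BallModel.J),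
      (∀ τ' : L →+* ℂ, InfinitePlace.mk τ' ≠ InfinitePlace.mk ι → (H.map τ').PosDef) →
      2 ≤ Module.finrank ℚ ↥(maximalRealSubfield L) →
      ∀ (μ : Measure (adelicGroupData (↥(maximalRealSubfield L)) L (IsCMField.complexConj L) 3 H).automorphicQuotient)
        [(adelicGroupData (↥(maximalRealSubfield L)) L (IsCMField.complexConj L) 3 H).IsAutomorphicMeasure μ]
        (μω : HeckeCharacter L) (hμu : μω.IsUnitary),
        (∀ x : Literature.NumberTheory.GaloisRepresentations.ideleGroup ↥(maximalRealSubfield L),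
          μω (AdeleRing.ideleBaseChange (↥(maximalRealSubfield L)) L x) = quadraticHeckeCharCM L x) →
      ∀ (P : DiscreteAutomorphicRep (adelicGroupData (↥(maximalRealSubfield L)) L (IsCMField.complexConj L) 3 H) μ),
        (P.IsHolCotangentAt (cmArchSection L ι H T hT) (cmCompactFactor L ι H T hT) ∨
          P.IsAntiholCotangentAt (cmArchSection L ι H T hT) (cmCompactFactor L ι H T hT)) →
        (∀ k : (adelicGroupData (↥(maximalRealSubfield L)) L (IsCMField.complexConj L) 3 H).Adelic, k ∈ cmCompactFactor L ι H T hT →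
          ∀ v : P.space.toSubmodule, (adelicGroupData (↥(maximalRealSubfield L)) L (IsCMField.complexConj L) 3 H).rightRegular μ k
            (v : (adelicGroupData (↥(maximalRealSubfield L)) L (IsCMField.complexConj L) 3 H).L2 μ) = v) →
        ∀ (M : Type) [AddCommGroup M] [Module ℂ M]
          (σK : Representation ℂ (uFormGroup (Fin 2) (Fin 1)).maximalCompact M) (σ𝔤 : (uFormGroup (Fin 2) (Fin 1)).lie →ₗ⁅ℝ⁆ Module.End ℂ M)
          (hM : IsGKModule (uFormGroup (Fin 2) (Fin 1)) σK σ𝔤), IsIrreducibleGK σK σ𝔤 →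
          (∃ T₁ : P.archModuleCM ι T hT →ₗ[ℂ] M,
            (∀ (k : (uFormGroup (Fin 2) (Fin 1)).maximalCompact) (w : P.archModuleCM ι T hT), T₁ (P.archRepKCM ι T hT k w) = σK k (T₁ w)) ∧
              (∀ (X : (uFormGroup (Fin 2) (Fin 1)).lie) (w : P.archModuleCM ι T hT), T₁ (P.archRepLieCM ι T hT X w) = σ𝔤 X (T₁ w)) ∧ T₁ ≠ 0) →
          ∀ δ : ℤ, (δ = 1 ∨ δ = -1) → upqTypeClasses σK σ𝔤 hM.ad_compat 1 δ ≠ ⊥ →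
            ∃ ξ : OneDimAutRepH L,
              MemXiFamily P (transpose_map_cmConjRingHom_eq_of_frame L ι H T hT) (isUnit_det_of_frame L ι H T hT) μω hμu ξ)
    (hdef : ∀ τ' : L →+* ℂ, InfinitePlace.mk τ' ≠ InfinitePlace.mk ι → (H.map τ').PosDef) (h2 : 2 ≤ Module.finrank ℚ ↥(maximalRealSubfield L))
    (hμω : ∀ x : Literature.NumberTheory.GaloisRepresentations.ideleGroup ↥(maximalRealSubfield L),
      μω (AdeleRing.ideleBaseChange (↥(maximalRealSubfield L)) L x) = quadraticHeckeCharCM L x) :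
    CohClassRoutingCot L H hH hHd μω hμu μZ keys ι T hT μ := by
  intro P hP M _ _ σK σ𝔤 hM hirr htok δ hδ hne
  -- ORGAN FIN at the `K_c`-triviality of a cotangent `P` (★ `kcTrivial_of_isCot`): `∃ ξ, MemXiFamily P … ξ`
  obtain ⟨ξ, hmem⟩ := hFin L ι H T hT hdef h2 μ μω hμu hμω P hP (kcTrivial_of_isCot L H ι T hT μ P hP) M σK σ𝔤 hM hirr htok δ hδ hne
  -- the cofinite spherical constituent of a cotangent `P` (★ `cotSpherical`) and the local routing glue (★ `localRouting`)
  exact ⟨ξ, localRouting L H hH hHd μω hμu μZ keys μ P ξ hmem (cotSpherical L H ι T hT μ hdef h2 P hP)⟩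

/-! ## §2 All closer frames: the TYPE of the closer's `stub_L3` from ORGAN FIN -/

/-- **HEAD — `CohClassRoutingCotClosed` (the closer's `stub_L3` type, ★ `F0P3CohClassRoutingCot`) FROM ORGAN FIN ALONE.**  Hypothesis = the LEAF's `S2FinLetter` text token
for token; conclusion = the closed guarded routing letter over every closer frame.  DEBT PARTITION (books reading): the closer's chain `stub_S2sharp → stub_L3` consumes only
the finite-place organ FIN of #80's pay-down line; the archimedean organs PIN-ι ∕ PIN-τ serve P2's Day-X socket only.  Axioms = TRIO (FIN is a hypothesis here, not a `sorry`).
[cite: Rogawski1990, §15.3 ¶1 (p. 249); Thm. 13.3.6 (c) (p. 202); §14.6 Thm. 14.6.4 (p. 243); §13.1 p. 199] [cite: FlathCorvallis1979, Thm. 3] -/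
theorem cohClassRoutingCotClosed_of_s2Fin
    (hFin : ∀ (L : Type) [Field L] [NumberField L] [IsCMField L] (ι : L →+* ℂ) (H : Matrix (Fin 3) (Fin 3) L) (T : GL (Fin 3) ℂ)
      (hT : (T : Matrix (Fin 3) (Fin 3) ℂ)ᴴ * H.map ι * (T : Matrix (Fin 3) (Fin 3) ℂ) = Literature.Geometry.ComplexHyperbolic.BallModel.J),
      (∀ τ' : L →+* ℂ, InfinitePlace.mk τ' ≠ InfinitePlace.mk ι → (H.map τ').PosDef) →
      2 ≤ Module.finrank ℚ ↥(maximalRealSubfield L) →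
      ∀ (μ : Measure (adelicGroupData (↥(maximalRealSubfield L)) L (IsCMField.complexConj L) 3 H).automorphicQuotient)
        [(adelicGroupData (↥(maximalRealSubfield L)) L (IsCMField.complexConj L) 3 H).IsAutomorphicMeasure μ]
        (μω : HeckeCharacter L) (hμu : μω.IsUnitary),
        (∀ x : Literature.NumberTheory.GaloisRepresentations.ideleGroup ↥(maximalRealSubfield L),
          μω (AdeleRing.ideleBaseChange (↥(maximalRealSubfield L)) L x) = quadraticHeckeCharCM L x) →
      ∀ (P : DiscreteAutomorphicRep (adelicGroupData (↥(maximalRealSubfield L)) L (IsCMField.complexConj L) 3 H) μ),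
        (P.IsHolCotangentAt (cmArchSection L ι H T hT) (cmCompactFactor L ι H T hT) ∨
          P.IsAntiholCotangentAt (cmArchSection L ι H T hT) (cmCompactFactor L ι H T hT)) →
        (∀ k : (adelicGroupData (↥(maximalRealSubfield L)) L (IsCMField.complexConj L) 3 H).Adelic, k ∈ cmCompactFactor L ι H T hT →
          ∀ v : P.space.toSubmodule, (adelicGroupData (↥(maximalRealSubfield L)) L (IsCMField.complexConj L) 3 H).rightRegular μ k
            (v : (adelicGroupData (↥(maximalRealSubfield L)) L (IsCMField.complexConj L) 3 H).L2 μ) = v) →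
        ∀ (M : Type) [AddCommGroup M] [Module ℂ M]
          (σK : Representation ℂ (uFormGroup (Fin 2) (Fin 1)).maximalCompact M) (σ𝔤 : (uFormGroup (Fin 2) (Fin 1)).lie →ₗ⁅ℝ⁆ Module.End ℂ M)
          (hM : IsGKModule (uFormGroup (Fin 2) (Fin 1)) σK σ𝔤), IsIrreducibleGK σK σ𝔤 →
          (∃ T₁ : P.archModuleCM ι T hT →ₗ[ℂ] M,
            (∀ (k : (uFormGroup (Fin 2) (Fin 1)).maximalCompact) (w : P.archModuleCM ι T hT), T₁ (P.archRepKCM ι T hT k w) = σK k (T₁ w)) ∧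
              (∀ (X : (uFormGroup (Fin 2) (Fin 1)).lie) (w : P.archModuleCM ι T hT), T₁ (P.archRepLieCM ι T hT X w) = σ𝔤 X (T₁ w)) ∧ T₁ ≠ 0) →
          ∀ δ : ℤ, (δ = 1 ∨ δ = -1) → upqTypeClasses σK σ𝔤 hM.ad_compat 1 δ ≠ ⊥ →
            ∃ ξ : OneDimAutRepH L,
              MemXiFamily P (transpose_map_cmConjRingHom_eq_of_frame L ι H T hT) (isUnit_det_of_frame L ι H T hT) μω hμu ξ) :
    CohClassRoutingCotClosed :=
  fun L _ _ _ ι H T hT hH hHd hdef h2 μ _ μω hμu hμω _ _ μZ _ keys =>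
    cohClassRoutingCot_of_s2Fin L H hH hHd μω hμu μZ keys ι T hT μ hFin hdef h2 hμω

end Summit.HodgeConjecture.HodgeConjecture.Cruxes.H413.F0P3cCohClassRoutingCotOfS2Fin

end
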